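import Literature.MathematicalPhysics.QuantumFieldTheory.Balaban1983to89.B7Prop10GeneralRec
import Literature.MathematicalPhysics.QuantumFieldTheory.Balaban1983to89.B7Eq99ConcreteRec
import Literature.MathematicalPhysics.QuantumFieldTheory.Balaban1983to89.B7Eq208Analytic

/-!
# `Balaban1983to89.B7Prop10InLambdaRec` — [Balaban1985Averaging] p. 50 «u′ belongs to the class Λ_k(C₅α₄)» and p. 45 «the product u′u₁ belongs to some class Λ_k(O(1)(α₃ + α₄))», FOR THE
# RECORD (centred blocks, (0.4) average) — the record twin of the engine's `B7Prop10InLambda` (with the general-letter covariant telescoping the centred tree contours need)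

statement-level skeleton of published theorems with citation tags; proofs where landed; nothing here is a claim about the Yang–Mills mass gap

CITATION HEADER (lean-in-tree rule).  Cell `pub-ymgap`, seat `pub-ymgap-dag-n05-e` g36 (N05-REC LEAD PEN); item R1 ([3] layer), Sect. G block, file 5: the record twin of `B7Prop10InLambda`
(lit-balaban r05).  `--kind proof --supports stmt-QuantumFields-20541` (K0⁷; count-neutral; no definition).  Sources READ: [3] = [Balaban1985Averaging] p. 45 (176)–(179) and the paragraph after
(177), p. 46 (180)–(182), (186), p. 44 (166)–(167), p. 50 Prop. 10 (`paper:balaban1985-cmp98-averaging`); [I] = [Balaban1987RG1] (0.3)–(0.4) pp. 252–253.  REUSED BY NAME: this seat's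
`B7Prop10GeneralRec.prop10_generalZ'`, the record's `B7SectEFLinearisationRec.{utilGZ, vtilGZ, InLambdaZ, Cond166Z, Cond167Z}`, `B7SectCDGaugeAveragesRec.{uavgZ, R0avgZ, savgZ}`, `B7Eq99ConcreteRec.savgZ_const`,
the engine's `B7Prop9General.CovBondBd`, `B7Prop9Flat.SiteBd`, `B7Prop10General.{C6, C4G}`, `B7Prop6Bound.mul_sub_one_norm_le`, `B7Prop6Flat.norm_units_inv_sub_one_le`.

WHAT IS PROVED (sorry-free).  §0 identities: `R0avgZ_one_right`, `uavgZ_one_right`, `inLambdaZ_one`, `utilGZ_mul_uavgZ` ∕ `utilGZ_eq_uavgZ_mul_inv` ((178) = (179) for the record), `utilGZ_one_right`.  §1 COVARIANT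
TELESCOPING ALONG AN ARBITRARY WORD (the record's tree contours `treeWord (offZ L r)` have letters of both signs, unlike the engine's corner contours): `covWalk` (`≤ (1 + 2a)^{|Γ|} − 1`; a backward
letter costs `‖B⁻¹ − 1‖ ≤ 2‖B − 1‖`), `covWalk_linear` (`≤ 4|Γ|a`), `covBlockZ_of_covBondBd` (`≤ 4dL·a`).  §2 ★`inLambdaZ_of_prop10_generalZ` — «u′ ∈ Λ_k(U₀, C₆α₄)» for the record ((166) = (204);
(167) = (203) summed covariantly along the centred tree contour, `8d ≤ C₆`).  §3 ★`inLambdaZ_mul_of_prop10_generalZ` — «u′u₁ ∈ Λ_k(U₀, 2C₆(α₃ + α₄))» for the record, by (178) and (182).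
HONEST SCOPE.  Port of the engine's membership statements to the record's objects (constant `4dL` in place of `2dL` for the two-signed contour); nothing of [3]∕[I] asserted beyond what is proved;
`HThm4Rec` UNDISCHARGED; N05 discharged of record untouched; N07 not claimable; counts unmoved (typed 28∕28 · discharged 8∕28); one finite 𝕋⁴ programme at fixed ε — nothing continuum ∕ ℝ⁴ ∕ OS ∕ mass
gap ∕ Clay.  No `def`, no `instance`, no `notation`, no `sorry`.
-/

set_option autoImplicit false

noncomputable section

open NormedSpace Finset

namespace Literature.MathematicalPhysics.QuantumFieldTheory.Balaban1983to89.B7Prop10InLambdaRec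

open B7Prop1Explicit hiding Site
open B7Prop1Explicit renaming Site → SiteZ
open MatrixLog B7Eq92Concrete
open B7Eq99Concrete (R0fun R0fun_apply R0fun_add)
open B7Prop6Flat (norm_units_inv_sub_one_le)
open B7Prop9Flat (SiteBd C5')
open B7Prop9General (CovBondBd)
open B7Prop10General (C6 C4G)
open BlockAveragingZd (avgIterZ offZ)
open B7Prop3FlatRecSide (l1_offZ_le_dL)
open B7SectCDGaugeAveragesRec (uavgZ uavgZ_zero uavgZ_succ R0avgZ savgZ)
open B7SectEFLinearisationRec (utilGZ utilGZ_zero utilGZ_succ vtilGZ InLambdaZ Cond166Z Cond167Z)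
open B7Eq99ConcreteRec (savgZ_const)
open B7Prop10GeneralRec (prop10_generalZ')
open B7Eq208Analytic (prod_cov_split)

variable {d : ℕ}
variable {𝔸 : Type*} [NormedRing 𝔸] [NormOneClass 𝔸] [NormedAlgebra ℂ 𝔸] [CompleteSpace 𝔸]

/-! ## §0 With `u₁ = 1` the averages (178)/(179) are the averages (79)/(80); (178) = (179) for the record -/

omit [NormOneClass 𝔸] in
/-- `\overline{R₀1}(y) = 1` for the record's twisted average (78). [cite: Balaban1985Averaging, (78)–(79) p.30; Balaban1987RG1, (0.3) p.252] -/
theorem R0avgZ_one_right (L : ℕ) (V₀ : SiteZ d → Fin d → 𝔸ˣ) (y : SiteZ d) :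
    R0avgZ L V₀ (1 : SiteZ d → 𝔸ˣ) y = 1 := by
  have h : R0fun V₀ y (1 : SiteZ d → 𝔸ˣ) = fun _ => 1 := by
    funext x; simp
  simp only [R0avgZ]
  rw [h, savgZ_const]

omit [NormOneClass 𝔸] in
/-- `\overline{R₀1}ʲ = 1` for the record's `j`-fold averages (80). [cite: Balaban1985Averaging, (79)–(80) p.30] -/
theorem uavgZ_one_right (L : ℕ) (U₀ : SiteZ d → Fin d → 𝔸ˣ) : ∀ j : ℕ, uavgZ L U₀ (1 : SiteZ d → 𝔸ˣ) j = 1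
  | 0 => rfl
  | j + 1 => by
    funext z
    rw [uavgZ_succ, uavgZ_one_right L U₀ j, R0avgZ_one_right, Pi.one_apply]

omit [NormOneClass 𝔸] in
/-- `1 ∈ Λ_k(U₀, α₃)` for the record, for every `α₃, η ≥ 0`. [cite: Balaban1985Averaging, (166)–(167) p.44] -/
theorem inLambdaZ_one (L : ℕ) (U₀ : SiteZ d → Fin d → 𝔸ˣ) (k : ℕ) {α₃ η : ℝ} (hα : 0 ≤ α₃) (hη : 0 ≤ η) :
    InLambdaZ L U₀ (1 : SiteZ d → 𝔸ˣ) k α₃ η := by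
  refine ⟨fun j _ z => ?_, fun j _ z r => ?_⟩
  · rw [uavgZ_one_right]; simpa using hα
  · rw [uavgZ_one_right]
    simp only [Pi.one_apply, inv_one, one_mul, map_one, Units.val_one, sub_self, norm_zero]
    positivity

omit [NormOneClass 𝔸] in
/-- **(178) = (179) for the record**: `ũ′ʲ · \overline{R₀u₁}ʲ = \overline{R₀u′u₁}ʲ`. [cite: Balaban1985Averaging, (178)–(179) p.45] -/
theorem utilGZ_mul_uavgZ (L : ℕ) (U₀ : SiteZ d → Fin d → 𝔸ˣ) (u' u₁ : SiteZ d → 𝔸ˣ) :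
    ∀ j : ℕ, utilGZ L U₀ u' u₁ j * uavgZ L U₀ u₁ j = uavgZ L U₀ (u' * u₁) j
  | 0 => by
    funext z
    simp only [Pi.mul_apply, utilGZ_zero, uavgZ_zero]
  | j + 1 => by
    funext z
    have ih := utilGZ_mul_uavgZ L U₀ u' u₁ j
    simp only [Pi.mul_apply, utilGZ_succ, uavgZ_succ, vtilGZ, inv_mul_cancel_right, ih]

omit [NormOneClass 𝔸] in
/-- **(178) for the record**, verbatim: `ũ′ʲ(z) = \overline{R₀u′u₁}ʲ(z)·(\overline{R₀u₁}ʲ(z))⁻¹`. [cite: Balaban1985Averaging, (178) p.45, (79)–(80) p.30] -/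
theorem utilGZ_eq_uavgZ_mul_inv (L : ℕ) (U₀ : SiteZ d → Fin d → 𝔸ˣ) (u' u₁ : SiteZ d → 𝔸ˣ) (j : ℕ) (z : SiteZ d) :
    utilGZ L U₀ u' u₁ j z = uavgZ L U₀ (u' * u₁) j z * (uavgZ L U₀ u₁ j z)⁻¹ := by
  have h := congrFun (utilGZ_mul_uavgZ L U₀ u' u₁ j) z
  simp only [Pi.mul_apply] at h
  rw [← h, mul_inv_cancel_right]

omit [NormOneClass 𝔸] in
/-- **(178)/(179) with `u₁ = 1` are (79)/(80)** for the record: `ũ′ʲ[u′, 1] = \overline{R₀u′}ʲ`. [cite: Balaban1985Averaging, (178)–(179) p.45, (79)–(80) p.30, Proposition 10 p.50] -/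
theorem utilGZ_one_right (L : ℕ) (U₀ : SiteZ d → Fin d → 𝔸ˣ) (u' : SiteZ d → 𝔸ˣ) (j : ℕ) :
    utilGZ L U₀ u' (1 : SiteZ d → 𝔸ˣ) j = uavgZ L U₀ u' j := by
  have h := utilGZ_mul_uavgZ L U₀ u' (1 : SiteZ d → 𝔸ˣ) j
  rwa [uavgZ_one_right, mul_one, mul_one] at h

/-! ## §1 Covariant telescoping along an arbitrary lattice word -/

omit [NormOneClass 𝔸] [NormedAlgebra ℂ 𝔸] [CompleteSpace 𝔸] in
/-- One covariant step splits off: `v(x)⁻¹R(S·H)v(x″) = [v(x)⁻¹R(S)v(x′)]·R(S)[v(x′)⁻¹R(H)v(x″)]`. [cite: Balaban1985Averaging, (57) p.27, (186) p.46] -/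
theorem cov_step_split (S H A B C : 𝔸ˣ) :
    A⁻¹ * Rc (S * H) C = (A⁻¹ * Rc S B) * Rc S (B⁻¹ * Rc H C) := by
  simp only [Rc_apply, mul_inv_rev]
  group

omit [NormOneClass 𝔸] [NormedAlgebra ℂ 𝔸] [CompleteSpace 𝔸] in
/-- A BACKWARD bond `x → x − e_κ` carries the inverse-conjugate of the covariant bond quantity at `x − e_κ`: `v(x)⁻¹R(V₀(b)⁻¹)v(x − e_κ) = R(V₀(b)⁻¹)[(v(x−e_κ)⁻¹R(V₀(b))v(x))⁻¹]`, `b = ⟨x − e_κ, x⟩`.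
[cite: Balaban1985Averaging, (186) p.46, (56)–(57) p.27] -/
theorem cov_step_back (g A B : 𝔸ˣ) : A⁻¹ * Rc g⁻¹ B = Rc g⁻¹ ((B⁻¹ * Rc g A)⁻¹) := by
  simp only [Rc_apply, mul_inv_rev, inv_inv]
  group

omit [NormedAlgebra ℂ 𝔸] [CompleteSpace 𝔸] in
/-- **Covariant telescoping along an ARBITRARY word, product form**: at a `U1`-valued background with the covariant bond condition (180b) `≤ a`, `a ≤ ½`, for every lattice word `Γ` from `x`:
`‖v(x)⁻¹R(V₀(Γ))v(x + disp Γ) − 1‖ ≤ (1 + 2a)^{|Γ|} − 1` (a forward letter costs `a`, a backward letter `2a`). [cite: Balaban1985Averaging, (186) p.46, (182) p.46, (180) p.46] -/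
theorem covWalk {V₀ : SiteZ d → Fin d → 𝔸ˣ} (hV : ∀ x κ, V₀ x κ ∈ U1 𝔸) {v : SiteZ d → 𝔸ˣ} {a : ℝ}
    (hv : CovBondBd V₀ v a) (ha2 : a ≤ 1 / 2) :
    ∀ (w : List (Letter d)) (x : SiteZ d),
      ‖((((v x)⁻¹ * Rc (hol V₀ x w) (v (x + disp w)) : 𝔸ˣ)) : 𝔸) - 1‖ ≤ (1 + 2 * a) ^ w.length - 1
  | [], x => by simp
  | l :: w, x => by
    have ha0 : 0 ≤ a := (norm_nonneg _).trans (hv x l.1)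
    have hstep : ‖((((v x)⁻¹ * Rc (stepHol V₀ x l) (v (x + l.vec)) : 𝔸ˣ)) : 𝔸) - 1‖ ≤ 2 * a := by
      obtain ⟨κ, s⟩ := l
      cases s
      · -- backward letter
        have hx : x + Letter.vec ((κ, false) : Letter d) = x - e κ := by simp [sub_eq_add_neg]
        rw [show stepHol V₀ x (κ, false) = (V₀ (x + Letter.vec ((κ, false) : Letter d)) κ)⁻¹ from rfl, hx, cov_step_back,
          Rc_apply, Units.val_mul, Units.val_mul]
        refine (norm_units_inv_conj_sub_one_le (hV _ _) _).trans ?_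
        have hb : ‖((((v (x - e κ))⁻¹ * Rc (V₀ (x - e κ) κ) (v x) : 𝔸ˣ)) : 𝔸) - 1‖ ≤ a := by
          have := hv (x - e κ) κ; rwa [sub_add_cancel] at this
        exact (norm_units_inv_sub_one_le _ (hb.trans ha2)).trans (by linarith)
      · rw [stepHol_true, Letter.vec_true]
        exact (hv x κ).trans (by linarith)
    rw [hol_cons, disp_cons, ← add_assoc,
      cov_step_split (stepHol V₀ x l) (hol V₀ (x + l.vec) w) (v x) (v (x + l.vec)) (v (x + l.vec + disp w)), Units.val_mul]
    have h2 : ‖(((Rc (stepHol V₀ x l) ((v (x + l.vec))⁻¹ * Rc (hol V₀ (x + l.vec) w) (v (x + l.vec + disp w))) : 𝔸ˣ)) : 𝔸) - 1‖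
        ≤ (1 + 2 * a) ^ w.length - 1 := by
      rw [Rc_apply, Units.val_mul, Units.val_mul]
      exact (norm_units_conj_sub_one_le (stepHol_mem hV x l) _).trans (covWalk hV hv ha2 w (x + l.vec))
    have hpow : (0 : ℝ) ≤ (1 + 2 * a) ^ w.length := by positivity
    calc _ ≤ (1 + ‖((((v x)⁻¹ * Rc (stepHol V₀ x l) (v (x + l.vec)) : 𝔸ˣ)) : 𝔸) - 1‖) *
          (1 + ‖(((Rc (stepHol V₀ x l) ((v (x + l.vec))⁻¹ * Rc (hol V₀ (x + l.vec) w) (v (x + l.vec + disp w))) : 𝔸ˣ)) : 𝔸) - 1‖) - 1 :=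
        B7Prop6Bound.mul_sub_one_norm_le _ _
      _ ≤ (1 + 2 * a) * (1 + ((1 + 2 * a) ^ w.length - 1)) - 1 := by gcongr
      _ = (1 + 2 * a) ^ (w.length + 1) - 1 := by ring
      _ = (1 + 2 * a) ^ ((l :: w).length) - 1 := by rw [List.length_cons]

/-- `(1 + a)^n − 1 ≤ 2na` for `0 ≤ a`, `na ≤ 1`. [cite: Balaban1985Averaging, (182) p.46 (bookkeeping)] -/
theorem one_add_pow_sub_one_le {a : ℝ} (ha : 0 ≤ a) {n : ℕ} (hn : (n : ℝ) * a ≤ 1) :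
    (1 + a) ^ n - 1 ≤ 2 * ((n : ℝ) * a) := by
  have h1 : (1 + a) ^ n ≤ Real.exp ((n : ℝ) * a) := by
    calc (1 + a) ^ n ≤ (Real.exp a) ^ n := by
          gcongr
          have := Real.add_one_le_exp a
          linarith
      _ = Real.exp ((n : ℝ) * a) := by rw [← Real.exp_nat_mul]
  have hna : 0 ≤ (n : ℝ) * a := by positivity
  have h2 : |Real.exp ((n : ℝ) * a) - 1| ≤ 2 * |(n : ℝ) * a| :=
    Real.abs_exp_sub_one_le (by rw [abs_of_nonneg hna]; exact hn)
  rw [abs_of_nonneg hna] at h2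
  have h3 := le_abs_self (Real.exp ((n : ℝ) * a) - 1)
  linarith

omit [NormedAlgebra ℂ 𝔸] [CompleteSpace 𝔸] in
/-- **Covariant telescoping, linear form**: `‖v(x)⁻¹R(V₀(Γ))v(x + disp Γ) − 1‖ ≤ 4|Γ|a` for `0 ≤ a ≤ ½`, `2|Γ|a ≤ 1`. [cite: Balaban1985Averaging, (182) p.46, (186) p.46] -/
theorem covWalk_linear {V₀ : SiteZ d → Fin d → 𝔸ˣ} (hV : ∀ x κ, V₀ x κ ∈ U1 𝔸) {v : SiteZ d → 𝔸ˣ} {a : ℝ}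
    (hv : CovBondBd V₀ v a) (ha : 0 ≤ a) (ha2 : a ≤ 1 / 2) (w : List (Letter d)) (x : SiteZ d)
    (hn : (w.length : ℝ) * (2 * a) ≤ 1) :
    ‖((((v x)⁻¹ * Rc (hol V₀ x w) (v (x + disp w)) : 𝔸ˣ)) : 𝔸) - 1‖ ≤ 4 * ((w.length : ℝ) * a) := by
  have h := (covWalk hV hv ha2 w x).trans (one_add_pow_sub_one_le (by positivity) hn)
  linarith

omit [NormedAlgebra ℂ 𝔸] [CompleteSpace 𝔸] in
/-- **The (167)/(180d) block quantity from the bond condition (180b), centred block**: along the record's tree contour `Γ_{y,y+n}` (`|Γ| ≤ dL` bonds of both signs),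
`‖v(y)⁻¹R(V₀(Γ_{y,y+n}))v(y + n) − 1‖ ≤ 4dL·a` provided `0 ≤ a ≤ ½`, `2dL·a ≤ 1`. [cite: Balaban1985Averaging, (167) p.44, (180) p.46, (182) p.46; Balaban1987RG1, (0.3) p.252] -/
theorem covBlockZ_of_covBondBd {L : ℕ} {V₀ : SiteZ d → Fin d → 𝔸ˣ} (hV : ∀ x κ, V₀ x κ ∈ U1 𝔸) {v : SiteZ d → 𝔸ˣ} {a : ℝ}
    (hv : CovBondBd V₀ v a) (ha0 : 0 ≤ a) (ha2 : a ≤ 1 / 2) (hs : 2 * ((d : ℝ) * L * a) ≤ 1) (y : SiteZ d) (r : Fin d → Fin L) :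
    ‖((((v y)⁻¹ * Rc (hol V₀ y (treeWord (offZ L r))) (v (y + offZ L r)) : 𝔸ˣ)) : 𝔸) - 1‖ ≤ 4 * ((d : ℝ) * L * a) := by
  have hlen : ((treeWord (offZ L r)).length : ℝ) ≤ (d : ℝ) * L := by
    rw [length_treeWord]; exact_mod_cast l1_offZ_le_dL L r
  have hlen' : ((treeWord (offZ L r)).length : ℝ) * a ≤ (d : ℝ) * L * a := mul_le_mul_of_nonneg_right hlen ha0
  have h := covWalk_linear hV hv ha0 ha2 (treeWord (offZ L r)) y (by nlinarith)
  rw [disp_treeWord] at h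
  exact h.trans (by linarith)

/-! ## §2 «u′ belongs to the class Λ_k(C₅α₄)» (p. 50), for the record -/

omit [NormOneClass 𝔸] [NormedAlgebra ℂ 𝔸] [CompleteSpace 𝔸] in
/-- `C₆ = 2 + 256(d + 1)`. [cite: Balaban1985Averaging, Proposition 10 p.50 (bookkeeping)] -/
theorem C6_eq : C6 d = 2 + 256 * ((d : ℝ) + 1) := by
  unfold C6 B7Prop10Flat.C5 C5'; ring

/-- ★ **THE SENTENCE AFTER PROPOSITION 10 (p. 50), FOR THE RECORD: «u′ belongs to the class Λ_k(C₅α₄)»** — under the hypotheses of `B7Prop10GeneralRec.prop10_generalZ` for `u′` alone ((176), (177), level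
backgrounds in `U1` with «`α₀` replaced by `2α₀(Lʲη)²`», the explicit smallness), `u′ ∈ Λ_k(U₀, C₆α₄)`: (166) is (204) for `ũ′ʲ[u′, 1] = \overline{R₀u′}ʲ`; (167) is (203) summed covariantly along the centred
tree contour (`≤ 4dL·2α₄Lʲη = 8dα₄L^{j+1}η`, `8d ≤ C₆`). [cite: Balaban1985Averaging, Proposition 10 p.50, (203)–(204) p.49, (166)–(167) p.44, (176)–(179) p.45; Balaban1987RG1, (0.3) p.252] -/
theorem inLambdaZ_of_prop10_generalZ {L s : ℕ} (hLs : L = 2 * s + 1) (hs1 : 1 ≤ s) (hd : 1 ≤ d) {U₀ : SiteZ d → Fin d → 𝔸ˣ} {k : ℕ}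
    {u' : SiteZ d → 𝔸ˣ} {α₀ α₄ η : ℝ}
    (hV : ∀ j < k, ∀ (x : SiteZ d) (κ : Fin d), avgIterZ L U₀ j x κ ∈ U1 𝔸)
    (h52 : ∀ j < k, ∀ (x : SiteZ d) (κ μ : Fin d), κ ≠ μ →
      ‖((hol (avgIterZ L U₀ j) x (plaqWord κ μ) : 𝔸ˣ) : 𝔸) - 1‖ ≤ 2 * α₀ * ((L : ℝ) ^ j * η) ^ 2)
    (h176 : SiteBd u' α₄) (h177 : CovBondBd U₀ u' (α₄ * η))
    (hη : 0 ≤ η) (hk : (L : ℝ) ^ k * η ≤ 1) (hα₀ : 0 ≤ α₀) (hα₄ : 0 ≤ α₄)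
    (hs₁ : 10 * C6 d * α₄ ≤ 1) (hs₂ : 3000 * ((d : ℝ) + 1) * L * α₄ ≤ 1) (hs₃ : C4G d L * (α₀ + α₄) ≤ 1)
    (hs₄ : 1024 * ((d : ℝ) + 1) * ((d : ℝ) + 4) * L ^ 2 * α₀ ≤ 1) (hs₅ : 32 * ((d : ℝ) + 1) ^ 2 * C6 d * L ^ 2 * α₀ ≤ 1)
    (hs₆ : 16 * d * C5' d * C6 d * (L : ℝ) ^ 2 * α₀ ≤ 1) :
    InLambdaZ L U₀ u' k (C6 d * α₄) η := by
  have hL1 : 1 ≤ L := by omega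
  have hLr : (1 : ℝ) ≤ L := by exact_mod_cast hL1
  have hdr : (0 : ℝ) ≤ d := Nat.cast_nonneg d
  have hC6 := C6_eq (d := d)
  have hs₃' : C4G d L * (α₀ + 0 + α₄) ≤ 1 := by rwa [add_zero]
  have hP := prop10_generalZ' hLs hs1 hd hV h52 h176 h177 (inLambdaZ_one L U₀ k le_rfl hη) hη hk hα₀ le_rfl
    (by norm_num) hα₄ hs₁ hs₂ hs₃' hs₄ hs₅ hs₆
  refine ⟨fun j hj z => ?_, fun j hj z r => ?_⟩
  · have h := (hP j hj).2 z
    rwa [utilGZ_one_right] at h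
  · have h203 : CovBondBd (avgIterZ L U₀ j) (uavgZ L U₀ u' j) (2 * α₄ * ((L : ℝ) ^ j * η)) := by
      have h := (hP j hj.le).1
      rwa [utilGZ_one_right] at h
    have ht : (L : ℝ) ^ (j + 1) * η ≤ 1 :=
      le_trans (mul_le_mul_of_nonneg_right (pow_le_pow_right₀ hLr (Nat.succ_le_of_lt hj)) hη) hk
    have ht0 : 0 ≤ (L : ℝ) ^ j * η := by positivity
    have ht1 : (L : ℝ) ^ j * η ≤ 1 := by
      have : (L : ℝ) ^ j * η ≤ (L : ℝ) ^ (j + 1) * η := mul_le_mul_of_nonneg_right (pow_le_pow_right₀ hLr (Nat.le_succ j)) hη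
      linarith
    have h4d : 8 * (d : ℝ) * α₄ ≤ 1 := by rw [hC6] at hs₁; nlinarith
    have ha2 : 2 * α₄ * ((L : ℝ) ^ j * η) ≤ 1 / 2 := by
      have hd1 : (1 : ℝ) ≤ d := by exact_mod_cast hd
      have : 2 * α₄ * ((L : ℝ) ^ j * η) ≤ 2 * α₄ * 1 := mul_le_mul_of_nonneg_left ht1 (by positivity)
      nlinarith
    have hsmall : 2 * ((d : ℝ) * L * (2 * α₄ * ((L : ℝ) ^ j * η))) ≤ 1 := by
      have e : 2 * ((d : ℝ) * L * (2 * α₄ * ((L : ℝ) ^ j * η))) = 4 * d * α₄ * ((L : ℝ) ^ (j + 1) * η) := by ring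
      rw [e]
      calc 4 * (d : ℝ) * α₄ * ((L : ℝ) ^ (j + 1) * η) ≤ 1 * 1 :=
            mul_le_mul (by linarith) ht (by positivity) (by norm_num)
        _ = 1 := one_mul 1
    have hw := covBlockZ_of_covBondBd (hV j hj) h203 (by positivity) ha2 hsmall ((L : ℤ) • z) r
    have e : 4 * ((d : ℝ) * L * (2 * α₄ * ((L : ℝ) ^ j * η))) = 8 * d * α₄ * ((L : ℝ) ^ (j + 1) * η) := by ring
    rw [e] at hw
    refine hw.trans ?_
    have hC : 8 * (d : ℝ) ≤ C6 d := by rw [hC6]; nlinarith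
    calc 8 * (d : ℝ) * α₄ * ((L : ℝ) ^ (j + 1) * η) = (8 * d) * (α₄ * ((L : ℝ) ^ (j + 1) * η)) := by ring
      _ ≤ C6 d * (α₄ * ((L : ℝ) ^ (j + 1) * η)) := mul_le_mul_of_nonneg_right hC (by positivity)
      _ = C6 d * α₄ * (L : ℝ) ^ (j + 1) * η := by ring

/-! ## §3 p. 45: «the product u′u₁ belongs to some class Λ_k(O(1)(α₃ + α₄))», for the record -/

omit [NormedAlgebra ℂ 𝔸] [CompleteSpace 𝔸] in
/-- The norm bookkeeping of (182): if `‖W − 1‖ ≤ w ≤ 1/50`, `‖A − 1‖ ≤ a`, `‖B − 1‖ ≤ b ≤ 1/50`, then `‖R(W⁻¹)A·B − 1‖ ≤ (6/5)a + b`. [cite: Balaban1985Averaging, (182) p.46 (bookkeeping)] -/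
theorem prod_bound {W A B : 𝔸ˣ} {a b w : ℝ} (hW : ‖(W : 𝔸) - 1‖ ≤ w) (hw : w ≤ 1 / 50)
    (hA : ‖(A : 𝔸) - 1‖ ≤ a) (hB : ‖(B : 𝔸) - 1‖ ≤ b) (hb : b ≤ 1 / 50) :
    ‖((Rc W⁻¹ A * B : 𝔸ˣ) : 𝔸) - 1‖ ≤ 6 / 5 * a + b := by
  have hw0 : 0 ≤ w := (norm_nonneg _).trans hW
  have ha0 : 0 ≤ a := (norm_nonneg _).trans hA
  have hb0 : 0 ≤ b := (norm_nonneg _).trans hB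
  have hWn : ‖(W : 𝔸)‖ ≤ 1 + w := by
    calc _ = ‖((W : 𝔸) - 1) + 1‖ := by rw [sub_add_cancel]
      _ ≤ ‖(W : 𝔸) - 1‖ + ‖(1 : 𝔸)‖ := norm_add_le _ _
      _ ≤ 1 + w := by rw [norm_one]; linarith
  have hWin : ‖((W⁻¹ : 𝔸ˣ) : 𝔸)‖ ≤ 1 + 2 * w := by
    have h1 := norm_units_inv_sub_one_le W (hW.trans (by linarith))
    calc _ = ‖(((W⁻¹ : 𝔸ˣ) : 𝔸) - 1) + 1‖ := by rw [sub_add_cancel]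
      _ ≤ ‖((W⁻¹ : 𝔸ˣ) : 𝔸) - 1‖ + ‖(1 : 𝔸)‖ := norm_add_le _ _
      _ ≤ 1 + 2 * w := by rw [norm_one]; linarith
  have hRcA : ‖((Rc W⁻¹ A : 𝔸ˣ) : 𝔸) - 1‖ ≤ (1 + 2 * w) * a * (1 + w) := by
    have hid : ((Rc W⁻¹ A : 𝔸ˣ) : 𝔸) - 1 = ((W⁻¹ : 𝔸ˣ) : 𝔸) * ((A : 𝔸) - 1) * (W : 𝔸) := by
      rw [Rc_apply, inv_inv, Units.val_mul, Units.val_mul, mul_sub, sub_mul, mul_one, Units.inv_mul]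
    rw [hid]
    calc _ ≤ ‖((W⁻¹ : 𝔸ˣ) : 𝔸)‖ * ‖(A : 𝔸) - 1‖ * ‖(W : 𝔸)‖ :=
        (norm_mul_le _ _).trans (mul_le_mul_of_nonneg_right (norm_mul_le _ _) (norm_nonneg _))
      _ ≤ (1 + 2 * w) * a * (1 + w) := by gcongr
  have hc0 : (1 + 2 * w) * (1 + w) ≤ 11 / 10 := by nlinarith
  have hc : (1 + 2 * w) * a * (1 + w) ≤ 11 / 10 * a :=
    calc (1 + 2 * w) * a * (1 + w) = ((1 + 2 * w) * (1 + w)) * a := by ring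
      _ ≤ 11 / 10 * a := mul_le_mul_of_nonneg_right hc0 ha0
  rw [Units.val_mul]
  calc _ ≤ (1 + ‖((Rc W⁻¹ A : 𝔸ˣ) : 𝔸) - 1‖) * (1 + ‖(B : 𝔸) - 1‖) - 1 := B7Prop6Bound.mul_sub_one_norm_le _ _
    _ ≤ (1 + 11 / 10 * a) * (1 + b) - 1 :=
      sub_le_sub_right (mul_le_mul (by linarith [hRcA.trans hc]) (by linarith) (by positivity) (by positivity)) 1
    _ ≤ 6 / 5 * a + b := by nlinarith

/-- ★ **p. 45, FOR THE RECORD: «if `u′` is such a configuration and `u₁ ∈ Λ_k(α₃)`, then `u′u₁ ∈ Λ_k(O(1)(α₃ + α₄))`»** — under the hypotheses of `B7Prop10GeneralRec.prop10_generalZ`,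
`InLambdaZ L U₀ (u′ * u₁) k (2C₆(α₃ + α₄)) η`: by (178) `\overline{R₀u′u₁}ʲ = ũ′ʲ·\overline{R₀u₁}ʲ`; (166) for the product is (204) × (166); (167) for the product is (182): the `ũ′ʲ`-quantity within `8dα₄L^{j+1}η`
of `1` ((203) summed along the centred tree contour, §1), the `ū₁ʲ`-quantity within `α₃L^{j+1}η`. [cite: Balaban1985Averaging, p.45 (paragraph after (177)), Proposition 10 p.50, (178) p.45, (182) p.46, (166)–(167) p.44] -/
theorem inLambdaZ_mul_of_prop10_generalZ {L s : ℕ} (hLs : L = 2 * s + 1) (hs1 : 1 ≤ s) (hd : 1 ≤ d) {U₀ : SiteZ d → Fin d → 𝔸ˣ} {k : ℕ}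
    {u' u₁ : SiteZ d → 𝔸ˣ} {α₀ α₃ α₄ η : ℝ}
    (hV : ∀ j < k, ∀ (x : SiteZ d) (κ : Fin d), avgIterZ L U₀ j x κ ∈ U1 𝔸)
    (h52 : ∀ j < k, ∀ (x : SiteZ d) (κ μ : Fin d), κ ≠ μ →
      ‖((hol (avgIterZ L U₀ j) x (plaqWord κ μ) : 𝔸ˣ) : 𝔸) - 1‖ ≤ 2 * α₀ * ((L : ℝ) ^ j * η) ^ 2)
    (h176 : SiteBd u' α₄) (h177 : CovBondBd U₀ u' (α₄ * η)) (hu₁ : InLambdaZ L U₀ u₁ k α₃ η)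
    (hη : 0 ≤ η) (hk : (L : ℝ) ^ k * η ≤ 1) (hα₀ : 0 ≤ α₀) (hα₃ : 0 ≤ α₃) (hα₃' : α₃ ≤ 1 / 50) (hα₄ : 0 ≤ α₄)
    (hs₁ : 10 * C6 d * α₄ ≤ 1) (hs₂ : 3000 * ((d : ℝ) + 1) * L * α₄ ≤ 1) (hs₃ : C4G d L * (α₀ + α₃ + α₄) ≤ 1)
    (hs₄ : 1024 * ((d : ℝ) + 1) * ((d : ℝ) + 4) * L ^ 2 * α₀ ≤ 1) (hs₅ : 32 * ((d : ℝ) + 1) ^ 2 * C6 d * L ^ 2 * α₀ ≤ 1)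
    (hs₆ : 16 * d * C5' d * C6 d * (L : ℝ) ^ 2 * α₀ ≤ 1) :
    InLambdaZ L U₀ (u' * u₁) k (2 * C6 d * (α₃ + α₄)) η := by
  have hL1 : 1 ≤ L := by omega
  have hLr : (1 : ℝ) ≤ L := by exact_mod_cast hL1
  have hdr : (0 : ℝ) ≤ d := Nat.cast_nonneg d
  have hd1 : (1 : ℝ) ≤ d := by exact_mod_cast hd
  have hC6 := C6_eq (d := d)
  have hC60 : (0 : ℝ) ≤ C6 d := by rw [hC6]; positivity
  have hP := prop10_generalZ' hLs hs1 hd hV h52 h176 h177 hu₁ hη hk hα₀ hα₃ hα₃' hα₄ hs₁ hs₂ hs₃ hs₄ hs₅ hs₆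
  have hfun : ∀ j, uavgZ L U₀ (u' * u₁) j = utilGZ L U₀ u' u₁ j * uavgZ L U₀ u₁ j := fun j => (utilGZ_mul_uavgZ L U₀ u' u₁ j).symm
  refine ⟨fun j hj z => ?_, fun j hj z r => ?_⟩
  · have hU : ‖((utilGZ L U₀ u' u₁ j z : 𝔸ˣ) : 𝔸) - 1‖ ≤ C6 d * α₄ := (hP j hj).2 z
    have hW : ‖((uavgZ L U₀ u₁ j z : 𝔸ˣ) : 𝔸) - 1‖ ≤ α₃ := hu₁.1 j hj z
    rw [hfun j, Pi.mul_apply, Units.val_mul]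
    have hX0 := norm_nonneg (((utilGZ L U₀ u' u₁ j z : 𝔸ˣ) : 𝔸) - 1)
    have hca : C6 d * α₄ * α₃ ≤ α₃ / 10 := by nlinarith
    calc _ ≤ (1 + ‖((utilGZ L U₀ u' u₁ j z : 𝔸ˣ) : 𝔸) - 1‖) * (1 + ‖((uavgZ L U₀ u₁ j z : 𝔸ˣ) : 𝔸) - 1‖) - 1 :=
        B7Prop6Bound.mul_sub_one_norm_le _ _
      _ ≤ (1 + C6 d * α₄) * (1 + α₃) - 1 :=
        sub_le_sub_right (mul_le_mul (by linarith) (by linarith) (by positivity)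
          (by linarith [mul_nonneg hC60 hα₄])) 1
      _ ≤ 2 * C6 d * (α₃ + α₄) := by nlinarith
  · have ht : (L : ℝ) ^ (j + 1) * η ≤ 1 :=
      le_trans (mul_le_mul_of_nonneg_right (pow_le_pow_right₀ hLr (Nat.succ_le_of_lt hj)) hη) hk
    have ht0 : 0 ≤ (L : ℝ) ^ (j + 1) * η := by positivity
    have ht1 : (L : ℝ) ^ j * η ≤ 1 := by
      have : (L : ℝ) ^ j * η ≤ (L : ℝ) ^ (j + 1) * η := mul_le_mul_of_nonneg_right (pow_le_pow_right₀ hLr (Nat.le_succ j)) hη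
      linarith
    have h203 : CovBondBd (avgIterZ L U₀ j) (utilGZ L U₀ u' u₁ j) (2 * α₄ * ((L : ℝ) ^ j * η)) := (hP j hj.le).1
    have h4d : 8 * (d : ℝ) * α₄ ≤ 1 := by rw [hC6] at hs₁; nlinarith
    have ha2 : 2 * α₄ * ((L : ℝ) ^ j * η) ≤ 1 / 2 := by
      have : 2 * α₄ * ((L : ℝ) ^ j * η) ≤ 2 * α₄ * 1 := mul_le_mul_of_nonneg_left ht1 (by positivity)
      nlinarith
    have hsmall : 2 * ((d : ℝ) * L * (2 * α₄ * ((L : ℝ) ^ j * η))) ≤ 1 := by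
      have e : 2 * ((d : ℝ) * L * (2 * α₄ * ((L : ℝ) ^ j * η))) = 4 * d * α₄ * ((L : ℝ) ^ (j + 1) * η) := by ring
      rw [e]
      calc 4 * (d : ℝ) * α₄ * ((L : ℝ) ^ (j + 1) * η) ≤ 1 * 1 :=
            mul_le_mul (by linarith) ht (by positivity) (by norm_num)
        _ = 1 := one_mul 1
    have hA := covBlockZ_of_covBondBd (hV j hj) h203 (by positivity) ha2 hsmall ((L : ℤ) • z) r
    have e : 4 * ((d : ℝ) * L * (2 * α₄ * ((L : ℝ) ^ j * η))) = 8 * d * α₄ * ((L : ℝ) ^ (j + 1) * η) := by ring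
    rw [e] at hA
    have hB := hu₁.2 j hj z r
    have hWy : ‖((uavgZ L U₀ u₁ j ((L : ℤ) • z) : 𝔸ˣ) : 𝔸) - 1‖ ≤ α₃ := hu₁.1 j hj.le _
    have hb : α₃ * (L : ℝ) ^ (j + 1) * η ≤ 1 / 50 := by
      rw [mul_assoc]
      calc α₃ * ((L : ℝ) ^ (j + 1) * η) ≤ 1 / 50 * 1 := mul_le_mul hα₃' ht ht0 (by norm_num)
        _ = 1 / 50 := by norm_num
    rw [hfun j, Pi.mul_apply, Pi.mul_apply, prod_cov_split]
    refine (prod_bound hWy hα₃' hA hB hb).trans ?_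
    rw [hC6]
    nlinarith [mul_nonneg hα₃ ht0, mul_nonneg hα₄ ht0, mul_nonneg (mul_nonneg hdr hα₃) ht0,
      mul_nonneg (mul_nonneg hdr hα₄) ht0]

end Literature.MathematicalPhysics.QuantumFieldTheory.Balaban1983to89.B7Prop10InLambdaRec
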